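/-
Copyright (c) 2026 the pub-hodgecm-mathlib formalisation cell (harness21).  Prover seat hodgecm-mathlib-K2E4-p10 (g0), Track B ∕ K2-LIT
(build stream 29), h413 = `stmt-HodgeConjecture-24833`, line `K2_E4_SingularTransferKappaSign`, socket module «ArchLimitConstant», file #10
`sig_K2E4ExplicitArchConstantPhase` — helper §C (the smooth class-function twist `χ · τ_∞²` on `C_c^∞(H_∞)`).  2026-09-03.
-/
import Literature.NumberTheory.Rogawski1990.ArchSmooth2AmbientMultiplier              -- ★ `ArchSmooth₂.ambientMul`; brings ★ `coe_endoEmbArch_eq`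
import Literature.NumberTheory.Rogawski1990.ArchExplicitTransferFactorCurveSmooth      -- ★ `archHeckeValue_eq_prod_single`, the place factors `F_w` (`_single_mul ∕ _ne_zero ∕ continuousAt_`)
import Literature.NumberTheory.Rogawski1990.ArchExplicitTransferFactorTauContinuous    -- ★ `isOpen_setOf_isUnit_mixedSpace`, ★ `archHeckeValue_ne_zero_of_isUnit` (via …Regular)
import Literature.Analysis.SpecialFunctions.ContinuousMultiplicativeCharacterSmooth    -- ★ `contDiffAt_of_map_mul_complex` (continuous characters of `ℂˣ` are `C^∞`)
import Mathlib.Analysis.Calculus.BumpFunction.FiniteDimension                          -- `exists_contDiff_tsupport_subset`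
import HarnessLib

/-!
# Socket #10 `sig_K2E4ExplicitArchConstantPhase`, helper §C: a SMOOTH CLASS-FUNCTION CUT-OFF `χ` on `H_∞` with `χ(γ_H) = 1` such that `χ · τ_∞²` is a smooth
# class-function multiplier of `C_c^∞(H_∞)` (Rogawski 1990 §4.9 p. 55 «`τ(γ)`», Prop. 8.2.1 proof pp. 118–119; Tate 1967 §2.3; Bouaziz 1994 §2.3, §5.1)

Cell `hodgecm-mathlib`, crux H413 = `stmt-HodgeConjecture-24833`, route `HCCMUnconditional`; Track B «K2-LIT», line `K2_E4_SingularTransferKappaSign`, socket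
`…SigsArchLimitConstant.sig_K2E4ExplicitArchConstantPhase` (U6, #10).  THEOREMS ONLY (no `def`, no instance, no notation, no `sorry`); lane
`--supports stmt-HodgeConjecture-24833`.

WHY.  The conjugation symmetry of the `Δ‴_∞`-transfer (helpers §A, §B) turns a transfer pair `(a^H, a)` and a transfer `b^H` of `conj ∘ a` into the function
`d = χ · (b^H − τ_∞² · conj ∘ a^H)` whose stable orbital integrals vanish at every `G`-regular `γ_H′`; to feed `d` to socket #9 it must lie in `C_c^∞(H_∞)` (★ `ArchSmooth₂`).
`τ_∞(γ_H) = μ_∞(γ₂) μ_∞(det g) μ_∞(−χ_g(γ₂))⁻¹` (§2) is smooth only where `χ_g(γ₂)` is a unit, so a smooth CLASS-FUNCTION cut-off `χ` with `χ(γ_H ⊗ 1) = 1` supported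
there is inserted: `χ` and `χ · τ_∞²` are then restrictions along `ι_∞` of GLOBAL `C^∞` functions of the ambient invariants `(tr g, det g, γ₂) ∈ (L ⊗ ℝ)³` of the
pattern `ι_∞(g, u) = (g₀₀ 0 g₀₁; 0 u 0; g₁₀ 0 g₁₁)` (★ `coe_endoEmbArch_eq`), hence multipliers of `C_c^∞(H_∞)` (★ `ArchSmooth₂.ambientMul`), constant on conjugacy
and stable conjugacy classes.

* §1 `contDiffAt_archHeckeValue` — `μ_∞` is `C^∞` at every unit of `L ⊗ ℝ` (place factorisation ★ `archHeckeValue_eq_prod_single` + ★ `contDiffAt_of_map_mul_complex`).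
* §2 `archTau_eq_of_isUnit` — `τ_∞(γ_H) = μ_∞(γ₂)·μ_∞(det g)·μ_∞(−(γ₂² − tr g·γ₂ + det g))⁻¹` when `χ_g(γ₂)` is a unit (`χ_g = X² − tr g·X + det g`, `μ_∞(det g⁻¹) = μ_∞(det g)⁻¹`).
* §3 `trace_det_archGammaTwo_eq_of_isArchStablyConjH`, `isArchStablyConjH_conj`, `archTau_eq_of_isArchStablyConjH` — the invariants and `τ_∞` are constant on
  stable classes (and conjugacy classes) of `H_∞`.
* §4 **`exists_smooth_class_cutoff`** — for `γ_H ∈ H_∞` with `χ_g(γ₂)` a unit there is `χ : H_∞ → ℂ` with `χ γ_H = 1`, constant on stable classes and under conjugation,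
  such that `χ · f^H` and `χ · τ_∞² · f^H` are `ArchSmooth₂` for every `ArchSmooth₂` `f^H`.
HONEST LABEL: count-neutral helper; HC_CM is proved only modulo the 7 printed citations (2 remaining named inputs: hLiu418 = stmt-HodgeConjecture-24832,
h413 = stmt-HodgeConjecture-24833) until rung 0 closes.

## References
* [Rogawski1990] J. D. Rogawski, *Automorphic Representations of Unitary Groups in Three Variables*, Ann. of Math. Stud. 123 (1990), §4.9 p. 55, Prop. 8.2.1 proof
  pp. 118–119, §8.2 p. 123 (`μ_w(z) = (z∕|z|)^t |z|^s`).
* [TateThesis1967] J. Tate, *Fourier analysis in number fields and Hecke's zeta-functions*, in Cassels–Fröhlich (1967), §2.3 (quasi-characters of `ℂˣ`).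
* [Bouaziz1994IntegralesOrbitales] A. Bouaziz, *Intégrales orbitales sur les groupes de Lie réductifs*, Ann. Sci. ÉNS (4) 27 (1994), §2.3 p. 578, §5.1 p. 588.
* [BorelJacquet1979] A. Borel, H. Jacquet, *Automorphic forms and automorphic representations*, PSPM 33.1 (1979), §4.1.
-/

set_option autoImplicit false
set_option linter.dupNamespace false

noncomputable section

-- `Classical` is needed to see the Mathlib normed-space instances on `mixedSpace L` (note H5 of ★ `AdelicGLnGlue`)
open NumberField NumberField.InfinitePlace NumberField.mixedEmbedding Matrix Polynomial Filter Topology Set Function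
open scoped MatrixGroups Classical ContDiff

namespace Summit.HodgeConjecture.HodgeConjecture.Cruxes.H413.K2E4ExplicitArchConstantPhaseTwist

open Literature.NumberTheory.Automorphic Literature.NumberTheory.Automorphic.UnitaryGroup Literature.NumberTheory.Rogawski1990
open Literature.NumberTheory.GaloisRepresentations Literature.Analysis.SpecialFunctions

/-! ## §1 `μ_∞` is `C^∞` at the units of `L ⊗ ℝ` -/

section Hecke

variable (L : Type) [Field L] [NumberField L] [IsCMField L] (μ : HeckeCharacter L)

omit [IsCMField L] in
/-- Each place factor `F_w(z) = μ_∞(ι_w z)` is `C^∞` at `z ≠ 0` (a continuous multiplicative non-vanishing function on `ℂ ∖ {0}`, ★ `contDiffAt_of_map_mul_complex`).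
[cite: TateThesis1967, §2.3] [cite: Rogawski1990, §8.2 p. 123] -/
theorem contDiffAt_archHeckeValue_single (w : {w : InfinitePlace L // IsComplex w}) {n : WithTop ℕ∞} {z₀ : ℂ} (hz₀ : z₀ ≠ 0) :
    ContDiffAt ℝ n (fun z : ℂ => archHeckeValue L μ (((fun _ => 1, Pi.mulSingle w z) : mixedSpace L))) z₀ :=
  contDiffAt_of_map_mul_complex (fun _ _ hz hz' => archHeckeValue_single_mul L μ w hz hz') (fun _ hz => continuousAt_archHeckeValue_single L μ w hz)
    (fun _ hz => archHeckeValue_single_ne_zero L μ w hz) hz₀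

/-- **`μ_∞` IS `C^∞` AT EVERY UNIT OF `L ⊗ ℝ`**: near a unit `x`, `μ_∞(y) = Π_w F_w(y_w)` (★ `archHeckeValue_eq_prod_single`, the units being open ★
`isOpen_setOf_isUnit_mixedSpace`) with each `F_w` of class `C^∞` off `0`. [cite: TateThesis1967, §2.3; §4.3] [cite: Rogawski1990, §8.2 p. 123] -/
theorem contDiffAt_archHeckeValue {n : WithTop ℕ∞} {x : mixedSpace L} (hx : IsUnit x) : ContDiffAt ℝ n (archHeckeValue L μ) x := by
  have hev : archHeckeValue L μ =ᶠ[𝓝 x] fun y : mixedSpace L =>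
      ∏ w : {w : InfinitePlace L // IsComplex w}, archHeckeValue L μ (((fun _ => 1, Pi.mulSingle w (y.2 w)) : mixedSpace L)) := by
    filter_upwards [(isOpen_setOf_isUnit_mixedSpace L).mem_nhds hx] with y hy using archHeckeValue_eq_prod_single L μ hy
  refine ContDiffAt.congr_of_eventuallyEq ?_ hev
  refine contDiffAt_prod fun w _ => ?_
  have hxw : x.2 w ≠ 0 := ((Pi.isUnit_iff.1 (Prod.isUnit_iff.1 hx).2) w).ne_zero
  exact (contDiffAt_archHeckeValue_single L μ w hxw).comp x (((contDiff_apply ℝ ℂ w).comp contDiff_snd).contDiffAt)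

end Hecke

/-! ## §2 `τ_∞` as a function of `(tr g, det g, γ₂)` -/

section Tau

variable (L : Type) [Field L] [NumberField L] [IsCMField L] (μ : HeckeCharacter L)
  (k : ↥(arch (↥(maximalRealSubfield L)) L (IsCMField.complexConj L) 2 (Matrix.of fun i j : Fin 2 => if i.val + j.val + 1 = 2 then (1 : L) else 0)) ×
    ↥(arch (↥(maximalRealSubfield L)) L (IsCMField.complexConj L) 1 (Matrix.of fun i j : Fin 1 => if i.val + j.val + 1 = 1 then (1 : L) else 0)))

/-- `χ_g(γ₂) = γ₂² − tr g · γ₂ + det g` (`χ_g = X² − tr g · X + det g`, Mathlib `Matrix.charpoly_fin_two`). [cite: Rogawski1990, §4.9 p. 55] -/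
theorem eval_archCharpolyTwo_eq :
    (archCharpolyTwo L k).eval (archGammaTwo L k) =
      archGammaTwo L k * archGammaTwo L k -
          ((k.1.val : GL (Fin 2) (mixedSpace L)) : Matrix (Fin 2) (Fin 2) (mixedSpace L)).trace * archGammaTwo L k +
        ((k.1.val : GL (Fin 2) (mixedSpace L)) : Matrix (Fin 2) (Fin 2) (mixedSpace L)).det := by
  unfold archCharpolyTwo
  rw [Matrix.charpoly_fin_two]
  simp only [eval_add, eval_sub, eval_mul, eval_pow, eval_C, eval_X]
  ring

/-- `μ_∞(det g⁻¹) · μ_∞(det g) = 1`. [cite: Rogawski1990, §4.9 p. 55] -/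
theorem archHeckeValue_det_inv_mul_det :
    archHeckeValue L μ (((k.1.val : GL (Fin 2) (mixedSpace L))⁻¹ : GL (Fin 2) (mixedSpace L)) : Matrix (Fin 2) (Fin 2) (mixedSpace L)).det *
        archHeckeValue L μ ((k.1.val : GL (Fin 2) (mixedSpace L)) : Matrix (Fin 2) (Fin 2) (mixedSpace L)).det = 1 := by
  have hu1 : IsUnit (((k.1.val : GL (Fin 2) (mixedSpace L))⁻¹ : GL (Fin 2) (mixedSpace L)) : Matrix (Fin 2) (Fin 2) (mixedSpace L)).det :=
    (Matrix.isUnits_det_units _)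
  have hu2 : IsUnit ((k.1.val : GL (Fin 2) (mixedSpace L)) : Matrix (Fin 2) (Fin 2) (mixedSpace L)).det := Matrix.isUnits_det_units _
  rw [← archHeckeValue_mul L μ hu1 hu2, ← Matrix.det_mul, ← Units.val_mul, inv_mul_cancel, Units.val_one, Matrix.det_one]
  -- `μ_∞(1) = 1`
  have h1 := archHeckeValue_mul L μ (x := (1 : mixedSpace L)) (y := 1) isUnit_one isUnit_one
  rw [one_mul] at h1
  exact mul_left_cancel₀ (archHeckeValue_ne_zero_of_isUnit L μ isUnit_one) (h1.symm.trans (mul_one _).symm)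

/-- **`τ_∞(γ_H) = μ_∞(γ₂) · μ_∞(det g) · μ_∞(−(γ₂² − tr g·γ₂ + det g))⁻¹`** when `χ_g(γ₂)` is a unit (`τ_∞ = μ_∞(γ₂)·μ_∞(−χ_g(γ₂)·det g⁻¹)⁻¹`, ★ `archTau`;
multiplicativity of `μ_∞` on units ★ `archHeckeValue_mul`). [cite: Rogawski1990, §4.9 p. 55] -/
theorem archTau_eq_of_isUnit (hq : IsUnit ((archCharpolyTwo L k).eval (archGammaTwo L k))) :
    archTau L k μ =
      archHeckeValue L μ (archGammaTwo L k) * archHeckeValue L μ ((k.1.val : GL (Fin 2) (mixedSpace L)) : Matrix (Fin 2) (Fin 2) (mixedSpace L)).det *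
        (archHeckeValue L μ (-(archGammaTwo L k * archGammaTwo L k -
            ((k.1.val : GL (Fin 2) (mixedSpace L)) : Matrix (Fin 2) (Fin 2) (mixedSpace L)).trace * archGammaTwo L k +
          ((k.1.val : GL (Fin 2) (mixedSpace L)) : Matrix (Fin 2) (Fin 2) (mixedSpace L)).det)))⁻¹ := by
  have hdi : IsUnit (((k.1.val : GL (Fin 2) (mixedSpace L))⁻¹ : GL (Fin 2) (mixedSpace L)) : Matrix (Fin 2) (Fin 2) (mixedSpace L)).det :=
    Matrix.isUnits_det_units _
  have hneg : IsUnit (-((archCharpolyTwo L k).eval (archGammaTwo L k))) := hq.neg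
  unfold archTau archTauArg
  rw [archHeckeValue_mul L μ hneg hdi, eval_archCharpolyTwo_eq, mul_inv, eq_inv_of_mul_eq_one_left (archHeckeValue_det_inv_mul_det L μ k), inv_inv]
  ring

end Tau

/-! ## §3 `(tr g, det g, γ₂)` and `τ_∞` are constant on (stable) conjugacy classes of `H_∞` -/

section Invariants

variable (L : Type) [Field L] [NumberField L] [IsCMField L]
  (k k' y : ↥(arch (↥(maximalRealSubfield L)) L (IsCMField.complexConj L) 2 (Matrix.of fun i j : Fin 2 => if i.val + j.val + 1 = 2 then (1 : L) else 0)) ×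
    ↥(arch (↥(maximalRealSubfield L)) L (IsCMField.complexConj L) 1 (Matrix.of fun i j : Fin 1 => if i.val + j.val + 1 = 1 then (1 : L) else 0)))

/-- **The invariants `(tr g, det g, γ₂)` are constant on STABLE classes of `H_∞`** (componentwise `GL`-conjugacy over `L ⊗ ℝ`; `γ₂ = det` of a `1 × 1` block).
[cite: Rogawski1990, §3.1 p. 19; §4.9 p. 55] [cite: Bouaziz1994IntegralesOrbitales, §2.3 p. 578] -/
theorem trace_det_archGammaTwo_eq_of_isArchStablyConjH (h : IsArchStablyConjH L k k') :
    (((k'.1.val : GL (Fin 2) (mixedSpace L)) : Matrix (Fin 2) (Fin 2) (mixedSpace L)).trace,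
        ((k'.1.val : GL (Fin 2) (mixedSpace L)) : Matrix (Fin 2) (Fin 2) (mixedSpace L)).det, archGammaTwo L k') =
      (((k.1.val : GL (Fin 2) (mixedSpace L)) : Matrix (Fin 2) (Fin 2) (mixedSpace L)).trace,
        ((k.1.val : GL (Fin 2) (mixedSpace L)) : Matrix (Fin 2) (Fin 2) (mixedSpace L)).det, archGammaTwo L k) := by
  obtain ⟨h₁, h₂⟩ := h
  obtain ⟨c, hc⟩ := isConj_iff.1 h₁
  obtain ⟨d, hd⟩ := isConj_iff.1 h₂
  have e1 : ((k'.1.val : GL (Fin 2) (mixedSpace L)) : Matrix (Fin 2) (Fin 2) (mixedSpace L)) =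
      (c : Matrix (Fin 2) (Fin 2) (mixedSpace L)) * ((k.1.val : GL (Fin 2) (mixedSpace L)) : Matrix (Fin 2) (Fin 2) (mixedSpace L)) *
        ((c⁻¹ : GL (Fin 2) (mixedSpace L)) : Matrix (Fin 2) (Fin 2) (mixedSpace L)) := by
    rw [← hc, Units.val_mul, Units.val_mul]
  have e2 : ((k'.2.val : GL (Fin 1) (mixedSpace L)) : Matrix (Fin 1) (Fin 1) (mixedSpace L)) =
      (d : Matrix (Fin 1) (Fin 1) (mixedSpace L)) * ((k.2.val : GL (Fin 1) (mixedSpace L)) : Matrix (Fin 1) (Fin 1) (mixedSpace L)) *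
        ((d⁻¹ : GL (Fin 1) (mixedSpace L)) : Matrix (Fin 1) (Fin 1) (mixedSpace L)) := by
    rw [← hd, Units.val_mul, Units.val_mul]
  have e3 : archGammaTwo L k' = archGammaTwo L k := by
    unfold archGammaTwo
    rw [← Matrix.det_fin_one ((k'.2.val : GL (Fin 1) (mixedSpace L)) : Matrix (Fin 1) (Fin 1) (mixedSpace L)),
      ← Matrix.det_fin_one ((k.2.val : GL (Fin 1) (mixedSpace L)) : Matrix (Fin 1) (Fin 1) (mixedSpace L)), e2, Matrix.det_units_conj]
  rw [e3, e1, Matrix.trace_units_conj, Matrix.det_units_conj]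

/-- Conjugacy inside `H_∞` is stable conjugacy: `IsArchStablyConjH L k (y * k * y⁻¹)`. [cite: Rogawski1990, §3.1 p. 19] -/
theorem isArchStablyConjH_conj : IsArchStablyConjH L k (y * k * y⁻¹) := by
  refine ⟨isConj_iff.2 ⟨(y.1.val : GL (Fin 2) (mixedSpace L)), ?_⟩, isConj_iff.2 ⟨(y.2.val : GL (Fin 1) (mixedSpace L)), ?_⟩⟩
  · simp [Prod.fst_mul, Prod.fst_inv]
  · simp [Prod.snd_mul, Prod.snd_inv]

/-- **`τ_∞` is constant on stable classes of `H_∞`** (it is a function of `(tr g, det g, γ₂)`: ★ `archTau`, `χ_g = X² − tr g·X + det g`, `det g⁻¹ = (det g)⁻¹`).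
[cite: Rogawski1990, §4.9 p. 55] -/
theorem archTau_eq_of_isArchStablyConjH (μ : HeckeCharacter L) (h : IsArchStablyConjH L k k') : archTau L k' μ = archTau L k μ := by
  have hinv := trace_det_archGammaTwo_eq_of_isArchStablyConjH L k k' h
  simp only [Prod.mk.injEq] at hinv
  obtain ⟨htr, hdet, hγ₂⟩ := hinv
  have hdet' : (((k'.1.val : GL (Fin 2) (mixedSpace L))⁻¹ : GL (Fin 2) (mixedSpace L)) : Matrix (Fin 2) (Fin 2) (mixedSpace L)).det =
      (((k.1.val : GL (Fin 2) (mixedSpace L))⁻¹ : GL (Fin 2) (mixedSpace L)) : Matrix (Fin 2) (Fin 2) (mixedSpace L)).det := by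
    rw [Matrix.coe_units_inv, Matrix.coe_units_inv, Matrix.det_nonsing_inv, Matrix.det_nonsing_inv, hdet]
  unfold archTau archTauArg
  rw [eval_archCharpolyTwo_eq, eval_archCharpolyTwo_eq, htr, hdet, hγ₂, hdet']

end Invariants

/-! ## §4 The smooth class-function cut-off -/

section Cutoff

variable (L : Type) [Field L] [NumberField L] [IsCMField L] (μ : HeckeCharacter L)

-- the scoped `ℓ^∞`-operator norm on `M₃(L ⊗ ℝ)` (the one through which ★ `IsArchSmooth` ∕ ★ `ArchSmooth₂.ambientMul` speak)
open scoped Matrix.Norms.Operator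

omit [IsCMField L] in
set_option backward.isDefEq.respectTransparency false in
/-- The ambient invariant map `X ↦ (X₀₀ + X₂₂, X₀₀X₂₂ − X₀₂X₂₀, X₁₁) : M₃(L ⊗ ℝ) → (L ⊗ ℝ)³` of the pattern `ι_∞(g, u) = (g₀₀ 0 g₀₁; 0 u 0; g₁₀ 0 g₁₁)` is `C^∞`
(polynomial in the entries; the entries are `ℝ`-linear on a finite-dimensional space). [cite: BorelJacquet1979, §4.1] -/
theorem contDiff_ambientInvariants :
    ContDiff ℝ ∞ fun X : Matrix (Fin 3) (Fin 3) (mixedSpace L) => (X 0 0 + X 2 2, X 0 0 * X 2 2 - X 0 2 * X 2 0, X 1 1) := by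
  haveI : FiniteDimensional ℝ (Matrix (Fin 3) (Fin 3) (mixedSpace L)) := finiteDimensional_matrix_mixedSpace
  have hent : ∀ i j : Fin 3, ContDiff ℝ ∞ fun X : Matrix (Fin 3) (Fin 3) (mixedSpace L) => X i j := fun i j =>
    (LinearMap.toContinuousLinearMap (⟨⟨fun X => X i j, fun _ _ => rfl⟩, fun _ _ => rfl⟩ : Matrix (Fin 3) (Fin 3) (mixedSpace L) →ₗ[ℝ] mixedSpace L)).contDiff
  exact ((hent 0 0).add (hent 2 2)).prodMk ((((hent 0 0).mul (hent 2 2)).sub ((hent 0 2).mul (hent 2 0))).prodMk (hent 1 1))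

/-- **On `ι_∞(H_∞)` the ambient invariants ARE `(tr g, det g, γ₂)`** (★ `coe_endoEmbArch_eq`; `tr`, `det` of a `2 × 2` matrix). [cite: Rogawski1990, §4.8 Case (a) p. 53; §4.9 p. 55] -/
theorem ambientInvariants_endoEmbArch
    (k : ↥(arch (↥(maximalRealSubfield L)) L (IsCMField.complexConj L) 2 (Matrix.of fun i j : Fin 2 => if i.val + j.val + 1 = 2 then (1 : L) else 0)) ×
      ↥(arch (↥(maximalRealSubfield L)) L (IsCMField.complexConj L) 1 (Matrix.of fun i j : Fin 1 => if i.val + j.val + 1 = 1 then (1 : L) else 0))) :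
    ((((endoEmbArch L k).val : Matrix (Fin 3) (Fin 3) (mixedSpace L)) 0 0 + ((endoEmbArch L k).val : Matrix (Fin 3) (Fin 3) (mixedSpace L)) 2 2,
        ((endoEmbArch L k).val : Matrix (Fin 3) (Fin 3) (mixedSpace L)) 0 0 * ((endoEmbArch L k).val : Matrix (Fin 3) (Fin 3) (mixedSpace L)) 2 2 -
          ((endoEmbArch L k).val : Matrix (Fin 3) (Fin 3) (mixedSpace L)) 0 2 * ((endoEmbArch L k).val : Matrix (Fin 3) (Fin 3) (mixedSpace L)) 2 0,
        ((endoEmbArch L k).val : Matrix (Fin 3) (Fin 3) (mixedSpace L)) 1 1) : mixedSpace L × mixedSpace L × mixedSpace L) =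
      (((k.1.val : GL (Fin 2) (mixedSpace L)) : Matrix (Fin 2) (Fin 2) (mixedSpace L)).trace,
        ((k.1.val : GL (Fin 2) (mixedSpace L)) : Matrix (Fin 2) (Fin 2) (mixedSpace L)).det, archGammaTwo L k) := by
  rw [coe_endoEmbArch_eq, Matrix.trace_fin_two, Matrix.det_fin_two]
  unfold archGammaTwo
  simp only [Matrix.of_apply, Matrix.cons_val', Matrix.cons_val_zero, Matrix.cons_val_one, Matrix.cons_val_two, Matrix.empty_val',
    Matrix.cons_val_fin_one, Matrix.head_cons, Matrix.tail_cons, Matrix.head_fin_const]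

/-- A smooth cut-off times a function smooth on a neighbourhood of its support is smooth everywhere (elementary `C^∞` bookkeeping). [cite: Bouaziz1994IntegralesOrbitales, §2.3 p. 578] -/
theorem contDiff_mul_of_tsupport_subset {E : Type*} [NormedAddCommGroup E] [NormedSpace ℝ E] {Ξ F : E → ℂ} {V : Set E}
    (hΞ : ContDiff ℝ ∞ Ξ) (hsupp : tsupport Ξ ⊆ V) (hF : ∀ x ∈ V, ContDiffAt ℝ ∞ F x) : ContDiff ℝ ∞ fun x => Ξ x * F x := by
  rw [contDiff_iff_contDiffAt]
  intro x
  by_cases hx : x ∈ V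
  · exact hΞ.contDiffAt.mul (hF x hx)
  · have hx' : x ∉ tsupport Ξ := fun h => hx (hsupp h)
    refine (contDiffAt_const (c := (0 : ℂ))).congr_of_eventuallyEq ?_
    filter_upwards [(isClosed_tsupport Ξ).isOpen_compl.mem_nhds hx'] with x' hx''
    rw [image_eq_zero_of_notMem_tsupport hx'', zero_mul]

/-- **THE SMOOTH CLASS-FUNCTION CUT-OFF.**  For `γ_H ∈ H_∞` with `χ_g(γ₂)` a unit of `L ⊗ ℝ` there is `χ : H_∞ → ℂ` with `χ γ_H = 1`, constant on stable classes, such that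
`k ↦ χ k · f^H k` and `k ↦ χ k · τ_∞(k)² · f^H k` are `ArchSmooth₂` whenever `f^H` is: `χ = Ξ ∘ (tr g, det g, γ₂)` for a smooth bump `Ξ` on `(L ⊗ ℝ)³` equal to `1`
at `(tr g, det g, γ₂)(γ_H)` and supported where `γ₂`, `det g`, `γ₂² − tr g·γ₂ + det g` are units (there `τ_∞` is the `C^∞` function of §2, ★ `contDiffAt_archHeckeValue`);
both multipliers are restrictions along `ι_∞` of global `C^∞` functions on `M₃(L ⊗ ℝ)` (★ `ArchSmooth₂.ambientMul`).
[cite: Rogawski1990, §4.9 p. 55; Prop. 8.2.1 proof pp. 118–119] [cite: Bouaziz1994IntegralesOrbitales, §2.3 p. 578; §5.1 p. 588] [cite: BorelJacquet1979, §4.1] -/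
theorem exists_smooth_class_cutoff
    (k₀ : ↥(arch (↥(maximalRealSubfield L)) L (IsCMField.complexConj L) 2 (Matrix.of fun i j : Fin 2 => if i.val + j.val + 1 = 2 then (1 : L) else 0)) ×
      ↥(arch (↥(maximalRealSubfield L)) L (IsCMField.complexConj L) 1 (Matrix.of fun i j : Fin 1 => if i.val + j.val + 1 = 1 then (1 : L) else 0)))
    (hk₀ : IsUnit ((archCharpolyTwo L k₀).eval (archGammaTwo L k₀))) :
    ∃ χ : (↥(arch (↥(maximalRealSubfield L)) L (IsCMField.complexConj L) 2 (Matrix.of fun i j : Fin 2 => if i.val + j.val + 1 = 2 then (1 : L) else 0)) ×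
        ↥(arch (↥(maximalRealSubfield L)) L (IsCMField.complexConj L) 1 (Matrix.of fun i j : Fin 1 => if i.val + j.val + 1 = 1 then (1 : L) else 0))) → ℂ,
      χ k₀ = 1 ∧
      (∀ k k', IsArchStablyConjH L k k' → χ k' = χ k) ∧
      (∀ fH, ArchSmooth₂ L fH → ArchSmooth₂ L (fun k => χ k * fH k)) ∧
      (∀ fH, ArchSmooth₂ L fH → ArchSmooth₂ L (fun k => χ k * archTau L k μ ^ 2 * fH k)) := by
  -- the open set of «good» invariants and the base point
  obtain ⟨V, hVdef⟩ : ∃ V : Set (mixedSpace L × mixedSpace L × mixedSpace L),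
      V = {p | IsUnit p.2.2 ∧ IsUnit p.2.1 ∧ IsUnit (p.2.2 * p.2.2 - p.1 * p.2.2 + p.2.1)} := ⟨_, rfl⟩
  have hVopen : IsOpen V := by
    rw [hVdef]
    refine ((isOpen_setOf_isUnit_mixedSpace L).preimage (continuous_snd.comp continuous_snd)).inter
      (((isOpen_setOf_isUnit_mixedSpace L).preimage (continuous_fst.comp continuous_snd)).inter
        ((isOpen_setOf_isUnit_mixedSpace L).preimage ?_))
    exact ((continuous_snd.comp continuous_snd).mul (continuous_snd.comp continuous_snd)).sub
      (continuous_fst.mul (continuous_snd.comp continuous_snd)) |>.add (continuous_fst.comp continuous_snd)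
  set p₀ : mixedSpace L × mixedSpace L × mixedSpace L :=
    (((k₀.1.val : GL (Fin 2) (mixedSpace L)) : Matrix (Fin 2) (Fin 2) (mixedSpace L)).trace,
      ((k₀.1.val : GL (Fin 2) (mixedSpace L)) : Matrix (Fin 2) (Fin 2) (mixedSpace L)).det, archGammaTwo L k₀) with hp₀
  have hp₀V : p₀ ∈ V := by
    rw [hVdef]
    refine ⟨isUnit_archGammaTwo L k₀, Matrix.isUnits_det_units _, ?_⟩
    have e := eval_archCharpolyTwo_eq L k₀
    rw [← e]; exact hk₀
  -- the bump
  obtain ⟨Ξ, hΞsupp, -, hΞsmooth, -, hΞone⟩ := exists_contDiff_tsupport_subset (n := ⊤) (hVopen.mem_nhds hp₀V)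
  -- `τ_∞` read on the invariants
  obtain ⟨T, hTdef⟩ : ∃ T : mixedSpace L × mixedSpace L × mixedSpace L → ℂ,
      T = fun p => archHeckeValue L μ p.2.2 * archHeckeValue L μ p.2.1 * (archHeckeValue L μ (-(p.2.2 * p.2.2 - p.1 * p.2.2 + p.2.1)))⁻¹ := ⟨_, rfl⟩
  have hT : ∀ p ∈ V, ContDiffAt ℝ ∞ T p := by
    intro p hp
    rw [hVdef] at hp
    obtain ⟨hu, hδ, hq⟩ := hp
    rw [hTdef]
    have h22 : ContDiff ℝ ∞ fun p : mixedSpace L × mixedSpace L × mixedSpace L => p.2.2 := contDiff_snd.comp contDiff_snd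
    have h21 : ContDiff ℝ ∞ fun p : mixedSpace L × mixedSpace L × mixedSpace L => p.2.1 := contDiff_fst.comp contDiff_snd
    have hqf : ContDiff ℝ ∞ fun p : mixedSpace L × mixedSpace L × mixedSpace L => -(p.2.2 * p.2.2 - p.1 * p.2.2 + p.2.1) :=
      (((h22.mul h22).sub (contDiff_fst.mul h22)).add h21).neg
    refine ((((contDiffAt_archHeckeValue L μ hu).comp p h22.contDiffAt).mul ((contDiffAt_archHeckeValue L μ hδ).comp p h21.contDiffAt)).mul
      (((contDiffAt_archHeckeValue L μ hq.neg).comp p hqf.contDiffAt).inv (by exact archHeckeValue_ne_zero_of_isUnit L μ hq.neg)))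
  -- the two global multipliers on the invariant space
  have hΞC : ContDiff ℝ ∞ fun p => ((Ξ p : ℝ) : ℂ) := Complex.ofRealCLM.contDiff.comp hΞsmooth
  have hΞT : ContDiff ℝ ∞ fun p => ((Ξ p : ℝ) : ℂ) * T p ^ 2 := by
    refine contDiff_mul_of_tsupport_subset hΞC ?_ fun p hp => (hT p hp).pow 2
    refine (closure_mono fun p hp => ?_).trans hΞsupp
    rw [Function.mem_support] at hp ⊢
    exact fun h0 => hp (by rw [h0, Complex.ofReal_zero])
  -- the class function
  refine ⟨fun k => ((Ξ (((k.1.val : GL (Fin 2) (mixedSpace L)) : Matrix (Fin 2) (Fin 2) (mixedSpace L)).trace,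
      ((k.1.val : GL (Fin 2) (mixedSpace L)) : Matrix (Fin 2) (Fin 2) (mixedSpace L)).det, archGammaTwo L k) : ℝ) : ℂ), ?_, ?_, ?_, ?_⟩
  · -- `χ k₀ = 1`
    show ((Ξ p₀ : ℝ) : ℂ) = 1
    rw [hΞone, Complex.ofReal_one]
  · -- constant on stable classes
    intro k k' hkk'
    simp only [trace_det_archGammaTwo_eq_of_isArchStablyConjH L k k' hkk']
  · -- `χ · fH` is `ArchSmooth₂`
    intro fH hfH
    have h := hfH.ambientMul L (M := fun X : Matrix (Fin 3) (Fin 3) (mixedSpace L) => ((Ξ (X 0 0 + X 2 2, X 0 0 * X 2 2 - X 0 2 * X 2 0, X 1 1) : ℝ) : ℂ))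
      (hΞC.comp (contDiff_ambientInvariants L))
    refine (archSmooth₂_iff L _).2 ((archSmooth₂_iff L _).1 h |>.imp fun φ hφ => ⟨hφ.1, hφ.2.1, hφ.2.2.1, fun k => ?_⟩)
    rw [← hφ.2.2.2 k, ambientInvariants_endoEmbArch]
  · -- `χ · τ_∞² · fH` is `ArchSmooth₂`
    intro fH hfH
    have h := hfH.ambientMul L (M := fun X : Matrix (Fin 3) (Fin 3) (mixedSpace L) =>
      ((Ξ (X 0 0 + X 2 2, X 0 0 * X 2 2 - X 0 2 * X 2 0, X 1 1) : ℝ) : ℂ) * T (X 0 0 + X 2 2, X 0 0 * X 2 2 - X 0 2 * X 2 0, X 1 1) ^ 2)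
      (hΞT.comp (contDiff_ambientInvariants L))
    refine (archSmooth₂_iff L _).2 ((archSmooth₂_iff L _).1 h |>.imp fun φ hφ => ⟨hφ.1, hφ.2.1, hφ.2.2.1, fun k => ?_⟩)
    rw [← hφ.2.2.2 k]
    dsimp only
    rw [ambientInvariants_endoEmbArch]
    -- on the support of the bump, `T (tr g, det g, γ₂) = τ_∞(k)`
    by_cases hk : (((k.1.val : GL (Fin 2) (mixedSpace L)) : Matrix (Fin 2) (Fin 2) (mixedSpace L)).trace,
        ((k.1.val : GL (Fin 2) (mixedSpace L)) : Matrix (Fin 2) (Fin 2) (mixedSpace L)).det, archGammaTwo L k) ∈ V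
    · have hk' := hk
      rw [hVdef] at hk'
      obtain ⟨-, -, hq⟩ := hk'
      have hq' : IsUnit ((archCharpolyTwo L k).eval (archGammaTwo L k)) := by rw [eval_archCharpolyTwo_eq]; exact hq
      rw [archTau_eq_of_isUnit L μ k hq', hTdef]
    · have hΞ0 : Ξ (((k.1.val : GL (Fin 2) (mixedSpace L)) : Matrix (Fin 2) (Fin 2) (mixedSpace L)).trace,
          ((k.1.val : GL (Fin 2) (mixedSpace L)) : Matrix (Fin 2) (Fin 2) (mixedSpace L)).det, archGammaTwo L k) = 0 :=
        image_eq_zero_of_notMem_tsupport fun h => hk (hΞsupp h)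
      simp only [hΞ0, Complex.ofReal_zero, zero_mul]

end Cutoff

end Summit.HodgeConjecture.HodgeConjecture.Cruxes.H413.K2E4ExplicitArchConstantPhaseTwist

end
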